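import Summits.CriticalPhenomena.PercolationContinuityZ3.Theorems.PercNearOneGluingNoHeavyLowerTailAntitheticCycleContract
import HarnessLib

/-!
# `NoHeavyLowerTail` (stmt-CriticalPhenomena-4575) — antithetic cluster pairs: CONTRACTING a tied vertex of a cycle, the sum identity (THEOREM C,
# file C3b; prim-hp-2 gen 40, HOME/THEOREM-C-cycles.md "LEAN BLUEPRINT")

Support file (`--supports stmt-CriticalPhenomena-4575`, hull-port prover `prim-hp-2`, gen 40).  No definitions, no named facts, no sorries; standard
axioms.

SETTING as in file C3a (…CycleContract): big cycle `v 0 = s, …, v n, v (n+1) = v 0` (`n ≥ 3`), position `1 ≤ a ≤ n`, contracted cycle `skip v a`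
with the merged pair `e' = v (a−1) v (a+1)`, edge sets `E = edgeSet (n+1) v`, `E' = edgeSet n (skip v a)`.
* `Cyc.exists_mem_expand_iff` — the vertices covered by `expand C` are those covered by `C`, plus `v a` when `e' ∈ C`;
* `Cyc.not_reach_skip` — `v a` is never joined to `s` on the contracted cycle;
* `Cyc.reach_swap`, `Cyc.both_swap`, `Cyc.swap_mem_tset_iff` — for a tied colouring `ω'` (coordinates `e'` and `edge v a` agree), reachability
  from `s` in `swap ω'` on `E` is reachability in `ω'` on `E'` up to the vertex `v a`, which is never reached in both colours; hence the
  bicluster-avoidance constraints `tset_E(R,∅)` and `tset_{E'}(R,∅)` correspond;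
* `Cyc.delta_swap` — `Δ_E(F,G)(swap ω') = Δ_{E'}(F ∘ expand, G ∘ expand)(ω')`;
* `Cyc.contract_sum_eq` — **`2 · Σ_{ω ∈ tset_E(R,∅), edge v (a−1) ≡ edge v a} Δ_E(F,G)(ω) = T_{E'}(R,∅; F ∘ expand, G ∘ expand)`**: reindex by the
  involution `swap`, then pair `ω'` with `ω' ∆ {edge v a}` (the pair `edge v a` is not on the contracted cycle, so exactly one of the two is tied and
  both have the same clusters).
With the staircase lemma (…CycleStairSum) this is the induction step of THEOREM C (file C4, …Cycle).
[cite: VandenbergHaggstromKahn2005, §1 p. 3 (open cluster `C_s`)]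
-/

noncomputable section

namespace Summit.CriticalPhenomena.PercolationContinuityZ3.Theorems

open Literature.Probability.Percolation
open scoped Classical symmDiff

namespace Antithetic

namespace Cyc

variable {V : Type*} {n : ℕ} {v : ℕ → V} (hn : 3 ≤ n) (hinj : ∀ i j, i < n + 1 → j < n + 1 → v i = v j → i = j) (hper : v (n + 1) = v 0)
  {a : ℕ} (ha1 : 1 ≤ a) (han : a ≤ n)

section Vertices

/-- `expand` is increasing. -/
theorem expand_mono : Monotone (expand v a) := by
  intro C D hCD e he
  rcases he with ⟨h1, h2⟩ | ⟨h1, h2⟩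
  · exact Or.inl ⟨hCD h1, h2⟩
  · exact Or.inr ⟨hCD h1, h2⟩

include ha1 in
/-- **Vertices of an expanded edge set**: a vertex lies on a pair of `expand C` iff it lies on a pair of `C`, or it is `v a` and the merged pair
belongs to `C`. [this work] -/
theorem exists_mem_expand_iff (C : Set (Sym2 V)) (r : V) :
    (∃ f ∈ expand v a C, r ∈ f) ↔ (∃ f ∈ C, r ∈ f) ∨ (edge (skip v a) (a - 1) ∈ C ∧ r = v a) := by
  have e1 : edge v (a - 1) = s(v (a - 1), v a) := by unfold edge; rw [show a - 1 + 1 = a by omega]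
  have emid := edge_skip_mid (v := v) ha1
  constructor
  · rintro ⟨f, hf, hr⟩
    rcases hf with ⟨hfC, -⟩ | ⟨hmid, rfl | rfl⟩
    · exact Or.inl ⟨f, hfC, hr⟩
    · rw [e1] at hr
      rcases Sym2.mem_iff.1 hr with rfl | rfl
      · exact Or.inl ⟨_, hmid, by rw [emid]; exact Sym2.mem_mk_left _ _⟩
      · exact Or.inr ⟨hmid, rfl⟩
    · rcases Sym2.mem_iff.1 hr with rfl | rfl
      · exact Or.inr ⟨hmid, rfl⟩
      · exact Or.inl ⟨_, hmid, by rw [emid]; exact Sym2.mem_mk_right _ _⟩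
  · rintro (⟨f, hfC, hr⟩ | ⟨hmid, rfl⟩)
    · by_cases hfe : f = edge (skip v a) (a - 1)
      · subst hfe
        rw [emid] at hr
        rcases Sym2.mem_iff.1 hr with rfl | rfl
        · exact ⟨edge v (a - 1), Or.inr ⟨hfC, Or.inl rfl⟩, by rw [e1]; exact Sym2.mem_mk_left _ _⟩
        · exact ⟨edge v a, Or.inr ⟨hfC, Or.inr rfl⟩, Sym2.mem_mk_right _ _⟩
      · exact ⟨f, Or.inl ⟨hfC, hfe⟩, hr⟩
    · exact ⟨edge v a, Or.inr ⟨hmid, Or.inr rfl⟩, Sym2.mem_mk_left _ _⟩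

include hinj hper ha1 han

/-- The contracted cycle does not pass through `v a`. -/
theorem skip_ne {i : ℕ} (hi : i ≤ n) : skip v a i ≠ v a := by
  by_cases hia : i < a
  · rw [skip_lt hia]
    intro h
    have := hinj i a (by omega) (by omega) h
    omega
  · rw [skip_ge (not_lt.1 hia)]
    intro h
    by_cases hi1 : i + 1 < n + 1
    · have := hinj (i + 1) a hi1 (by omega) h
      omega
    · rw [show i + 1 = n + 1 by omega, hper] at h
      have := hinj 0 a (by omega) (by omega) h
      omega

/-- No pair of the contracted cycle contains `v a`. -/
theorem notMem_edge_skip {j : ℕ} (hj : j < n) : v a ∉ edge (skip v a) j := by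
  intro h
  rcases Sym2.mem_iff.1 h with h | h
  · exact skip_ne hinj hper ha1 han hj.le h.symm
  · exact skip_ne hinj hper ha1 han (by omega) h.symm

/-- The pair `edge v a` is not a pair of the contracted cycle. -/
theorem edge_a_notMem : edge v a ∉ edgeSet n (skip v a) := by
  rintro ⟨j, hj, he⟩
  exact notMem_edge_skip hinj hper ha1 han hj (he ▸ Sym2.mem_mk_left _ _)

/-- **`v a` is never joined to `s` on the contracted cycle.** [this work] -/
theorem not_reach_skip (η : Set (Sym2 V)) : ¬ (openGraph (η ∩ edgeSet n (skip v a))).Reachable (v 0) (v a) := by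
  refine Pendant.not_reachable_leaf _ _ (fun f hf hmem => ?_) fun h => ?_
  · obtain ⟨j, hj, rfl⟩ := hf.2
    exact absurd hmem (notMem_edge_skip hinj hper ha1 han hj)
  · have := hinj 0 a (by omega) (by omega) h
    omega

end Vertices

section Correspondence

include hn hinj hper ha1 han

/-- **Reachability corresponds** (tied colourings): `r` is joined to `s` in `swap ω'` on the big cycle iff it is in `ω'` on the contracted cycle,
or `r = v a` and the merged pair lies in the red cluster. [this work] -/
theorem reach_swap (ω' : Set (Sym2 V)) (hT : edge (skip v a) (a - 1) ∈ ω' ↔ edge v a ∈ ω') (r : V) :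
    (openGraph (swap v a ω' ∩ edgeSet (n + 1) v)).Reachable (v 0) r ↔
      (openGraph (ω' ∩ edgeSet n (skip v a))).Reachable (v 0) r ∨
        (edge (skip v a) (a - 1) ∈ openEdgeCluster (ω' ∩ edgeSet n (skip v a)) (v 0) ∧ r = v a) := by
  rw [Pendant.reachable_iff_cluster, Pendant.reachable_iff_cluster, cluster_swap hn hinj hper ha1 han ω' hT,
    exists_mem_expand_iff ha1, or_assoc]

/-- **Double reach corresponds** (tied colourings): `r` is joined to `s` in both colours of `swap ω'` on the big cycle iff it is in both colours
of `ω'` on the contracted cycle (the extra vertex `v a` is never doubly reached). [this work] -/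
theorem both_swap (ω' : Set (Sym2 V)) (hT : edge (skip v a) (a - 1) ∈ ω' ↔ edge v a ∈ ω') (r : V) :
    ((openGraph (swap v a ω' ∩ edgeSet (n + 1) v)).Reachable (v 0) r ∧
        (openGraph ((swap v a ω')ᶜ ∩ edgeSet (n + 1) v)).Reachable (v 0) r) ↔
      ((openGraph (ω' ∩ edgeSet n (skip v a))).Reachable (v 0) r ∧
        (openGraph (ω'ᶜ ∩ edgeSet n (skip v a))).Reachable (v 0) r) := by
  have hne := mid_ne hn hinj hper ha1 han
  have hT' : edge (skip v a) (a - 1) ∈ ω'ᶜ ↔ edge v a ∈ ω'ᶜ := by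
    rw [Set.mem_compl_iff, Set.mem_compl_iff, hT]
  rw [swap_compl hne, reach_swap hn hinj hper ha1 han ω' hT, reach_swap hn hinj hper ha1 han ω'ᶜ hT']
  by_cases hr : r = v a
  · subst hr
    have h0 := not_reach_skip hinj hper ha1 han (a := a) ω'
    have h0' := not_reach_skip hinj hper ha1 han (a := a) ω'ᶜ
    constructor
    · rintro ⟨h1 | ⟨h1, -⟩, h2 | ⟨h2, -⟩⟩
      · exact absurd h1 h0
      · exact absurd h1 h0
      · exact absurd h2 h0'
      · exact absurd ((mem_openEdgeCluster_iff _ _ _).1 h1).1.1 ((mem_openEdgeCluster_iff _ _ _).1 h2).1.1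
    · rintro ⟨h1, -⟩
      exact absurd h1 h0
  · simp only [hr, and_false, or_false]

/-- **Constraints correspond**: for a tied colouring `ω'`, `swap ω' ∈ tset_E(R,∅)` iff `ω' ∈ tset_{E'}(R,∅)`. [this work] -/
theorem swap_mem_tset_iff [Fintype V] (R : Set V) (ω' : Set (Sym2 V)) (hT : edge (skip v a) (a - 1) ∈ ω' ↔ edge v a ∈ ω') :
    swap v a ω' ∈ Peel.tset (edgeSet (n + 1) v) (v 0) R ∅ ↔ ω' ∈ Peel.tset (edgeSet n (skip v a)) (v 0) R ∅ := by
  rw [Peel.mem_tset, Peel.mem_tset]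
  constructor
  · rintro ⟨h, -⟩
    exact ⟨fun r hr => by rw [← both_swap hn hinj hper ha1 han ω' hT r]; exact h r hr, fun x hx => absurd hx (Set.notMem_empty x)⟩
  · rintro ⟨h, -⟩
    exact ⟨fun r hr => by rw [both_swap hn hinj hper ha1 han ω' hT r]; exact h r hr, fun x hx => absurd hx (Set.notMem_empty x)⟩

/-- **The functional corresponds**: `Δ_E(F,G)(swap ω') = Δ_{E'}(F ∘ expand, G ∘ expand)(ω')` for tied `ω'`. [this work] -/
theorem delta_swap (F G : Set (Sym2 V) → ℝ) (ω' : Set (Sym2 V)) (hT : edge (skip v a) (a - 1) ∈ ω' ↔ edge v a ∈ ω') :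
    Peel.delta F G (edgeSet (n + 1) v) (v 0) (swap v a ω') =
      Peel.delta (F ∘ expand v a) (G ∘ expand v a) (edgeSet n (skip v a)) (v 0) ω' := by
  have hne := mid_ne hn hinj hper ha1 han
  have hT' : edge (skip v a) (a - 1) ∈ ω'ᶜ ↔ edge v a ∈ ω'ᶜ := by
    rw [Set.mem_compl_iff, Set.mem_compl_iff, hT]
  unfold Peel.delta
  rw [swap_compl hne, cluster_swap hn hinj hper ha1 han ω' hT, cluster_swap hn hinj hper ha1 han ω'ᶜ hT']
  rfl

end Correspondence

section Flip

/-- Flipping a coordinate `x ∉ E` does not change the trace on `E`. -/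
theorem symmDiff_singleton_inter {ω E : Set (Sym2 V)} {x : Sym2 V} (hx : x ∉ E) : (ω ∆ {x}) ∩ E = ω ∩ E := by
  ext e
  simp only [Set.mem_inter_iff, Set.mem_symmDiff, Set.mem_singleton_iff]
  constructor
  · rintro ⟨⟨h, -⟩ | ⟨h, -⟩, he⟩
    · exact ⟨h, he⟩
    · exact absurd he (h ▸ hx)
  · rintro ⟨h, he⟩
    exact ⟨Or.inl ⟨h, fun hex => hx (hex ▸ he)⟩, he⟩

/-- Flipping a coordinate `x ∉ E` does not change the complementary trace on `E`. -/
theorem compl_symmDiff_singleton_inter {ω E : Set (Sym2 V)} {x : Sym2 V} (hx : x ∉ E) : (ω ∆ {x})ᶜ ∩ E = ωᶜ ∩ E := by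
  ext e
  simp only [Set.mem_inter_iff, Set.mem_compl_iff, Set.mem_symmDiff, Set.mem_singleton_iff, not_or, not_and, not_not]
  constructor
  · rintro ⟨⟨h1, -⟩, he⟩
    exact ⟨fun h => hx ((h1 h) ▸ he), he⟩
  · rintro ⟨h, he⟩
    exact ⟨⟨fun h' => absurd h' h, fun hex => absurd he (hex ▸ hx)⟩, he⟩

end Flip

section Sum

variable [Fintype V]
include hn hinj hper ha1 han

/-- **THE CONTRACTION IDENTITY (THEOREM C, step (ii) of the blueprint).**  On the big cycle `E` (`n + 1 ≥ 4` vertices) with a position `1 ≤ a ≤ n`: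
twice the constrained antithetic sum over the colourings of `tset_E(R,∅)` WITHOUT a colour change at `v a` equals the full constrained sum
`T_{E'}(R,∅)` of the contracted cycle `E'` for the pulled-back functions `F ∘ expand`, `G ∘ expand` (which are again increasing). [this work] -/
theorem contract_sum_eq (F G : Set (Sym2 V) → ℝ) (R : Set V) :
    2 * ∑ ω ∈ (Peel.tset (edgeSet (n + 1) v) (v 0) R ∅).filter (fun ω => (edge v (a - 1) ∈ ω ↔ edge v a ∈ ω)),
        Peel.delta F G (edgeSet (n + 1) v) (v 0) ω =
      Peel.tsum (F ∘ expand v a) (G ∘ expand v a) (edgeSet n (skip v a)) (v 0) R ∅ := by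
  have hne := mid_ne hn hinj hper ha1 han
  have hxe : edge v a ≠ edge (skip v a) (a - 1) := (mid_ne_edge hn hinj hper ha1 han (i := a) (by omega)).symm
  have hxa : edge v a ≠ edge v (a - 1) := fun h => by
    have := edge_inj (n := n + 1) (by omega) hinj hper (by omega) (by omega) h
    omega
  have hxE' := edge_a_notMem hinj hper ha1 han (n := n) (a := a)
  set E := edgeSet (n + 1) v with hE
  set E' := edgeSet n (skip v a) with hE'
  set T : Set (Sym2 V) → Prop := fun ω' => (edge (skip v a) (a - 1) ∈ ω' ↔ edge v a ∈ ω') with hTdef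
  -- Step 1: reindex the tied colourings of the big cycle by `swap`
  have step1 : ∑ ω ∈ (Peel.tset E (v 0) R ∅).filter (fun ω => (edge v (a - 1) ∈ ω ↔ edge v a ∈ ω)), Peel.delta F G E (v 0) ω =
      ∑ ω' ∈ (Peel.tset E' (v 0) R ∅).filter (fun ω' => T ω'), Peel.delta (F ∘ expand v a) (G ∘ expand v a) E' (v 0) ω' := by
    symm
    refine Finset.sum_nbij' (swap v a) (swap v a) ?_ ?_ (fun ω' _ => swap_swap hne ω') (fun ω _ => swap_swap hne ω) ?_
    · intro ω' hω'
      rw [Finset.mem_filter] at hω' ⊢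
      obtain ⟨hmem, hT⟩ := hω'
      refine ⟨(swap_mem_tset_iff hn hinj hper ha1 han R ω' hT).2 hmem, ?_⟩
      rw [mem_swap_am1 hne, mem_swap_other ω' hxe hxa]
      exact hT
    · intro ω hω
      rw [Finset.mem_filter] at hω ⊢
      obtain ⟨hmem, hTb⟩ := hω
      have hT : T (swap v a ω) := by
        show edge (skip v a) (a - 1) ∈ swap v a ω ↔ edge v a ∈ swap v a ω
        rw [mem_swap_mid hne, mem_swap_other ω hxe hxa]
        exact hTb
      refine ⟨(swap_mem_tset_iff hn hinj hper ha1 han R (swap v a ω) hT).1 ?_, hT⟩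
      rw [swap_swap hne]
      exact hmem
    · intro ω' hω'
      rw [Finset.mem_filter] at hω'
      exact (delta_swap hn hinj hper ha1 han F G ω' hω'.2).symm
  -- Step 2: on the contracted cycle, flipping the free coordinate `edge v a` exchanges tied and untied colourings
  have hflip_tset : ∀ ω' : Set (Sym2 V), ω' ∆ {edge v a} ∈ Peel.tset E' (v 0) R ∅ ↔ ω' ∈ Peel.tset E' (v 0) R ∅ := fun ω' => by
    rw [Peel.mem_tset, Peel.mem_tset, symmDiff_singleton_inter hxE', compl_symmDiff_singleton_inter hxE']
  have hflip_T : ∀ ω' : Set (Sym2 V), T (ω' ∆ {edge v a}) ↔ ¬ T ω' := fun ω' => by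
    have h1 : edge (skip v a) (a - 1) ∈ ω' ∆ {edge v a} ↔ edge (skip v a) (a - 1) ∈ ω' := by
      rw [Set.mem_symmDiff, Set.mem_singleton_iff]
      constructor
      · rintro (⟨h, -⟩ | ⟨h, -⟩)
        · exact h
        · exact absurd h hxe.symm
      · exact fun h => Or.inl ⟨h, hxe.symm⟩
    have h2 : edge v a ∈ ω' ∆ {edge v a} ↔ edge v a ∉ ω' := by
      rw [Set.mem_symmDiff, Set.mem_singleton_iff]
      constructor
      · rintro (⟨-, h⟩ | ⟨-, h⟩)
        · exact absurd rfl h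
        · exact h
      · exact fun h => Or.inr ⟨rfl, h⟩
    show ((edge (skip v a) (a - 1) ∈ ω' ∆ {edge v a} ↔ edge v a ∈ ω' ∆ {edge v a})) ↔ ¬ (edge (skip v a) (a - 1) ∈ ω' ↔ edge v a ∈ ω')
    rw [h1, h2]
    tauto
  have hflip_delta : ∀ ω' : Set (Sym2 V), Peel.delta (F ∘ expand v a) (G ∘ expand v a) E' (v 0) (ω' ∆ {edge v a}) =
      Peel.delta (F ∘ expand v a) (G ∘ expand v a) E' (v 0) ω' := fun ω' => by
    unfold Peel.delta
    rw [symmDiff_singleton_inter hxE', compl_symmDiff_singleton_inter hxE']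
  have step2 : ∑ ω' ∈ (Peel.tset E' (v 0) R ∅).filter (fun ω' => ¬ T ω'), Peel.delta (F ∘ expand v a) (G ∘ expand v a) E' (v 0) ω' =
      ∑ ω' ∈ (Peel.tset E' (v 0) R ∅).filter (fun ω' => T ω'), Peel.delta (F ∘ expand v a) (G ∘ expand v a) E' (v 0) ω' := by
    refine Finset.sum_nbij' (· ∆ {edge v a}) (· ∆ {edge v a}) ?_ ?_ (fun ω' _ => symmDiff_symmDiff_cancel_right _ _)
      (fun ω' _ => symmDiff_symmDiff_cancel_right _ _) fun ω' _ => (hflip_delta ω').symm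
    · intro ω' hω'
      rw [Finset.mem_filter] at hω' ⊢
      exact ⟨(hflip_tset ω').2 hω'.1, (hflip_T ω').2 hω'.2⟩
    · intro ω' hω'
      rw [Finset.mem_filter] at hω' ⊢
      refine ⟨(hflip_tset ω').2 hω'.1, fun h => ?_⟩
      have := (hflip_T (ω' ∆ {edge v a})).1 (by rw [symmDiff_symmDiff_cancel_right]; exact hω'.2)
      exact this h
  rw [step1, Peel.tsum, ← Finset.sum_filter_add_sum_filter_not (Peel.tset E' (v 0) R ∅) (fun ω' => T ω'), step2, two_mul]

end Sum

end Cyc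

end Antithetic

end Summit.CriticalPhenomena.PercolationContinuityZ3.Theorems
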